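import Mathlib

/-!
# BC5 rung for `QuarterJolt.NoTerminalJolt` (route QuarterJolt, D-0145 ideator ns-idea-9 g2) — the self-similar-rate caricature decides the jolt functional

For the kinematic self-similar-rate caricature `u t x = λ(t) • U (λ(t) • x)`, `λ(t) = (√(T - t))⁻¹`
(`t < T`), with EXTINCT terminal value `u T = 0`, the no-terminal-jolt functional
`D(t) = (√(T - t))⁻¹ · ∫ ‖u t x - u T x‖²` is CONSTANT, equal to `∫ ‖U‖²`, for every profile `U`
(no integrability needed: the change of variables is an identity of Bochner integrals). Hence the
analogue of `NoTerminalJolt` for the caricature holds iff the profile has zero `L²` mass: the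
normalisation `(T - t)^{-1/2} ‖·‖₂²` is exactly the self-similar one, and `NoTerminalJolt` is
precisely the exclusion of self-similar-rate `L²` approach to the terminal state — neither vacuous
nor implied by a Type-I bound.
-/

noncomputable section

namespace Summit.NavierStokesRegularity.NavierStokesRegularity.Theorems.QuarterJoltRung

open MeasureTheory Filter Set Topology

/-- The self-similar-rate caricature with extinct terminal value. -/
def ssCaricature (T : ℝ) (U : EuclideanSpace ℝ (Fin 3) → EuclideanSpace ℝ (Fin 3)) (t : ℝ)
    (x : EuclideanSpace ℝ (Fin 3)) : EuclideanSpace ℝ (Fin 3) :=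
  if t < T then (Real.sqrt (T - t))⁻¹ • U ((Real.sqrt (T - t))⁻¹ • x) else 0

/-- The terminal value of the caricature is the extinct state `0`. -/
theorem ssCaricature_top (T : ℝ) (U : EuclideanSpace ℝ (Fin 3) → EuclideanSpace ℝ (Fin 3))
    (x : EuclideanSpace ℝ (Fin 3)) : ssCaricature T U T x = 0 := by
  simp [ssCaricature]

/-- The jolt functional of the caricature is the constant `∫ ‖U‖²` before `T`. -/
theorem joltFunctional_ssCaricature {T t : ℝ} (ht : t < T)
    (U : EuclideanSpace ℝ (Fin 3) → EuclideanSpace ℝ (Fin 3)) :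
    (Real.sqrt (T - t))⁻¹ * ∫ x, ‖ssCaricature T U t x - ssCaricature T U T x‖ ^ 2
      = ∫ x, ‖U x‖ ^ 2 := by
  have hpos : 0 < Real.sqrt (T - t) := Real.sqrt_pos.2 (by linarith)
  set l : ℝ := (Real.sqrt (T - t))⁻¹ with hl
  have hl0 : 0 < l := inv_pos.2 hpos
  have h1 : (fun x => ‖ssCaricature T U t x - ssCaricature T U T x‖ ^ 2)
      = fun x => l ^ 2 * (fun y => ‖U y‖ ^ 2) (l • x) := by
    funext x
    simp only [ssCaricature, if_pos ht, lt_irrefl, if_false, sub_zero, norm_smul, Real.norm_eq_abs]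
    rw [← hl, abs_of_pos hl0, mul_pow]
  rw [h1, integral_const_mul, Measure.integral_comp_smul volume (fun y => ‖U y‖ ^ 2) l]
  have hfin : Module.finrank ℝ (EuclideanSpace ℝ (Fin 3)) = 3 := by simp
  rw [hfin, smul_eq_mul, abs_of_pos (inv_pos.2 (pow_pos hl0 3))]
  have hl1 : l ≠ 0 := hl0.ne'
  field_simp

/-- **BC5 rung (decided instance).** For the self-similar-rate caricature the analogue of
`NoTerminalJolt` holds iff the profile has zero `L²` mass. -/
theorem noTerminalJolt_ssCaricature_iff (T : ℝ)
    (U : EuclideanSpace ℝ (Fin 3) → EuclideanSpace ℝ (Fin 3)) :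
    Tendsto (fun t : ℝ => (Real.sqrt (T - t))⁻¹ *
        ∫ x, ‖ssCaricature T U t x - ssCaricature T U T x‖ ^ 2) (𝓝[<] T) (𝓝 0)
      ↔ ∫ x, ‖U x‖ ^ 2 = 0 := by
  have hev : (fun t : ℝ => (Real.sqrt (T - t))⁻¹ *
        ∫ x, ‖ssCaricature T U t x - ssCaricature T U T x‖ ^ 2)
      =ᶠ[𝓝[<] T] fun _ => ∫ x, ‖U x‖ ^ 2 := by
    filter_upwards [self_mem_nhdsWithin] with t ht
    exact joltFunctional_ssCaricature ht U
  constructor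
  · intro h
    have h' : Tendsto (fun _ : ℝ => ∫ x, ‖U x‖ ^ 2) (𝓝[<] T) (𝓝 0) := h.congr' hev
    exact tendsto_const_nhds_iff.1 h'
  · intro h0
    refine Tendsto.congr' hev.symm ?_
    rw [h0]
    exact tendsto_const_nhds

/-- In particular a nontrivial profile JOLTS: the caricature violates the no-terminal-jolt law. -/
theorem ssCaricature_jolts (T : ℝ) (U : EuclideanSpace ℝ (Fin 3) → EuclideanSpace ℝ (Fin 3))
    (hU : ∫ x, ‖U x‖ ^ 2 ≠ 0) :
    ¬ Tendsto (fun t : ℝ => (Real.sqrt (T - t))⁻¹ *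
        ∫ x, ‖ssCaricature T U t x - ssCaricature T U T x‖ ^ 2) (𝓝[<] T) (𝓝 0) :=
  fun h => hU ((noTerminalJolt_ssCaricature_iff T U).1 h)

end Summit.NavierStokesRegularity.NavierStokesRegularity.Theorems.QuarterJoltRung

end
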